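import Summits.KontsevichZagierPeriods.KontsevichZagierPeriods.Theses.TorsionLogs
import Literature.NumberTheory.Transcendental.KZKernelConjectureForms
import Literature.NumberTheory.Transcendental.KZTorusLogRep

/-!
# F4 ON-PATH lemma `KontsevichZagierPeriods → NeronTorsionJensen` (self-contained, sorry-free) — crux `TorsionSectorComplete` (stmt-KontsevichZagierPeriods-14212), line `NeronTorsionJensen`
(forward generator G1 `next-rung`, unit fwd2-rung-KontsevichZagierPeriods-01, gen 17): the typed rung
`NeronTorsionJensen` (member `false` = the floor `NeronTorsionPrimitiveChain` verbatim, member `true` =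
`NeronJensenSector`, the elliptic Jensen formula at a real torsion centre as a chain of KZ moves), its
stub statements, the proved glue and the on-path lemma. No `sorry` in this file.
-/

noncomputable section

open Set MeasureTheory
open Literature.NumberTheory.Transcendental
open Summit.KontsevichZagierPeriods.KontsevichZagierPeriods.Theses.TorsionLogs
  (NeronTorsionPrimitiveChain TorsionSectorComplete)

set_option linter.dupNamespace false

namespace Summit.KontsevichZagierPeriods.KontsevichZagierPeriods.Cruxes.TorsionSectorComplete.NeronTorsionJensen.OnPath

/-! ### Data: the real Weierstrass curve, the torsion centre, the Jensen representations -/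

/-- Mathlib-normalised model `Y² = X³ − (g₂/4)X − g₃/4` of `y² = f(x) = 4x³ − g₂x − g₃` (`y = 2Y`), as in
the floor. -/
def curve (g₂ g₃ : ℝ) : WeierstrassCurve ℝ := ⟨0, 0, 0, -g₂ / 4, -g₃ / 4⟩

/-- The `x`-coordinate of an affine point (junk value `0` at the point at infinity). -/
def xCoord {W : WeierstrassCurve ℝ} : W.toAffine.Point → ℝ
  | .zero => 0
  | @WeierstrassCurve.Affine.Point.some _ _ _ x _ _ => x

example {W : WeierstrassCurve ℝ} {x y : ℝ} (h : W.toAffine.Nonsingular x y) :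
    xCoord (WeierstrassCurve.Affine.Point.some x y h) = x := rfl

example {W : WeierstrassCurve ℝ} : xCoord (0 : W.toAffine.Point) = 0 := rfl

/-- The base of the unfolding: the unbounded real period cell `{x | e₁ < x}` (identity component
`E⁰(ℝ)` minus `O`, doubly covered by `(x, ±√f(x))`). -/
def base (e₁ : ℝ) : Set (Fin 1 → ℝ) := {x | e₁ < x 0}

/-- The invariant differential `dx/√f(x)` as the weight of the unfolding. -/
def weight (f : ℝ → ℝ) (x : Fin 1 → ℝ) : ℝ := (Real.sqrt (f (x 0)))⁻¹

/-- The Jensen kernel `(x − x_Q)²` (its signed log-unfolding has fibre value `2 log |x − x_Q|`). -/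
def centreSq (xQ : ℝ) (x : Fin 1 → ℝ) : ℝ := (x 0 - xQ) ^ 2

/-- **Torsion centre.** `f = 4x³ − g₂x − g₃` with `Δ ≠ 0`, `e₁` its largest real root (`f > 0` beyond
`e₁`), and `Q = (x_Q, y_Q)` a real point ON THE IDENTITY COMPONENT (`e₁ ≤ x_Q`) of exact order `N ≥ 2`
in `E(ℝ)` (Mathlib's group law on the model `curve g₂ g₃`, `Y = y/2`). -/
def TorsionCentre (g₂ g₃ e₁ xQ yQ : ℝ) (N : ℕ) (f : ℝ → ℝ) : Prop :=
  (∀ x, f x = 4 * x ^ 3 - g₂ * x - g₃) ∧ g₂ ^ 3 - 27 * g₃ ^ 2 ≠ 0 ∧ f e₁ = 0 ∧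
  (∀ x, e₁ < x → 0 < f x) ∧ e₁ ≤ xQ ∧ yQ ^ 2 = f xQ ∧ 2 ≤ N ∧
  (∀ hns : (curve g₂ g₃).toAffine.Nonsingular xQ (yQ / 2),
    addOrderOf (WeierstrassCurve.Affine.Point.some xQ (yQ / 2) hns) = N)

/-- The Jensen representation `R_Q`: the SIGNED unfolding (`KZ.logUnfoldDomain`, two sheets `u ≷ 1`)
of `log (x − x_Q)² · dx/√f(x)` over the base `{e₁ < x}`; a 2-dimensional KZ representation of
`2∫_{e₁}^∞ log|x − x_Q| dx/√f(x) = 2ω₁·λ_ℝ(Q)` (real-period Haar average of `log|x − x_Q|`). -/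
def JensenRep (f : ℝ → ℝ) (e₁ xQ : ℝ) (R : KZ.IntegralRep (1 + 1)) : Prop :=
  R.domain = KZ.logUnfoldDomain (base e₁) (centreSq xQ) ∧
  Set.EqOn R.integrand (KZ.logUnfoldIntegrand (weight f)) R.domain

/-- The carrier `C_B`: the signed unfolding of the CONSTANT `log B` over the same base
(value `(ω₁/2)·log B`; for `B < 1` the lower sheet carries the sign). -/
def CarrierRep (f : ℝ → ℝ) (e₁ B : ℝ) (C : KZ.IntegralRep (1 + 1)) : Prop :=
  C.domain = KZ.logUnfoldDomain (base e₁) (fun _ => B) ∧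
  Set.EqOn C.integrand (KZ.logUnfoldIntegrand (weight f)) C.domain

/-! ### The rung -/

/-- **Member `true` — `NeronJensenSector` (elliptic Jensen at a real torsion centre, TIED form).**
For a torsion centre `Q` of exact order `N` on `E⁰(ℝ)` and a real algebraic `α > 1`: whenever
`j·N·value(R_Q) = m·value(C_α)` (`j, m ∈ ℤ`), the element `(jN)•[R_Q] − m•[C_α]` is a chain of KZ moves.
Content: `N·value(R_Q) = value(C_{c_Q})` with `c_Q = ∏_{k<N} (x(P + kQ) − x_Q)²` the (constant, algebraic)
orbit norm — the elliptic Jensen formula `N(N−2)∫_{e₁}^∞ log|x−x_Q| dx/√f = ω₁ log|ψ_{N−1}(Q)|` — realised by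
moves: translation by `kQ` (rule 2) tiles the base `N`-to-`1` a.e., the fibrewise product rule (rules 1–2)
multiplies the kernels, and the product is the constant `c_Q`. The elliptic coefficient is a multiple of
`N` (coefficient `1` would need root extraction). -/
def NeronJensenSector : Prop :=
  ∀ (g₂ g₃ e₁ xQ yQ α : ℝ) (N : ℕ) (j m : ℤ) (f : ℝ → ℝ), TorsionCentre g₂ g₃ e₁ xQ yQ N f → 1 < α →
    ∀ (R C : KZ.IntegralRep (1 + 1)), JensenRep f e₁ xQ R → CarrierRep f e₁ α C →
      ((j : ℝ) * N) * R.value = m * C.value →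
      (j * (N : ℤ)) • KZ.of R - m • KZ.of C ∈ KZ.relations

/-- The typed family: member `false` = the floor decl verbatim, member `true` = `NeronJensenSector`. -/
def NeronJensenMember : Bool → Prop
  | false => NeronTorsionPrimitiveChain
  | true => NeronJensenSector

/-- **The rung `NeronTorsionJensen`**: both members. -/
def NeronTorsionJensen : Prop := ∀ b : Bool, NeronJensenMember b

/-! ### Stub statements -/

/-- **Stub 1 statement (algebraic): the orbit norm is constant.** For `Q` of exact order `N` the
function `P ↦ ∏_{k<N} (x(P + kQ) − x_Q)²` is constant (`= c_Q > 0`) on the real affine points `P ∉ ⟨Q⟩`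
(its divisor `2∑_k ((Q − kQ) + (−Q − kQ) − 2(−kQ))` vanishes). -/
def OrbitNormConstant : Prop :=
  ∀ (g₂ g₃ xQ Y : ℝ) (N : ℕ) (hQ : (curve g₂ g₃).toAffine.Nonsingular xQ Y),
    g₂ ^ 3 - 27 * g₃ ^ 2 ≠ 0 → 2 ≤ N →
    addOrderOf (WeierstrassCurve.Affine.Point.some xQ Y hQ) = N →
    ∃ c : ℝ, 0 < c ∧ ∀ (x y : ℝ) (h : (curve g₂ g₃).toAffine.Nonsingular x y),
      (∀ k : ℕ, k < N →
        WeierstrassCurve.Affine.Point.some x y h + k • WeierstrassCurve.Affine.Point.some xQ Y hQ ≠ 0) →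
      ∏ k ∈ Finset.range N,
        (xCoord (WeierstrassCurve.Affine.Point.some x y h
            + k • WeierstrassCurve.Affine.Point.some xQ Y hQ) - xQ) ^ 2 = c

/-- **Stub 2 statement (the real step): the orbit-averaged chain.** Given the constant orbit norm `c`,
`N•[R_Q] − [C_c] ∈ KZ.relations` for some carrier `C_c` pinned at `B = c` (value-free conclusion). -/
def JensenChainOfNorm : Prop :=
  ∀ (g₂ g₃ e₁ xQ yQ : ℝ) (N : ℕ) (f : ℝ → ℝ) (c : ℝ), TorsionCentre g₂ g₃ e₁ xQ yQ N f → 0 < c →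
    (∀ (hQ : (curve g₂ g₃).toAffine.Nonsingular xQ (yQ / 2)) (x y : ℝ)
        (h : (curve g₂ g₃).toAffine.Nonsingular x y),
      (∀ k : ℕ, k < N →
        WeierstrassCurve.Affine.Point.some x y h
          + k • WeierstrassCurve.Affine.Point.some xQ (yQ / 2) hQ ≠ 0) →
      ∏ k ∈ Finset.range N,
        (xCoord (WeierstrassCurve.Affine.Point.some x y h
            + k • WeierstrassCurve.Affine.Point.some xQ (yQ / 2) hQ) - xQ) ^ 2 = c) →
    ∀ (R : KZ.IntegralRep (1 + 1)), JensenRep f e₁ xQ R →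
      ∃ C : KZ.IntegralRep (1 + 1), CarrierRep f e₁ c C ∧ (N : ℤ) • KZ.of R - KZ.of C ∈ KZ.relations

/-- The interface between stubs 1–2 and stub 3: the Jensen chain with SOME positive carrier constant. -/
def JensenNormChain : Prop :=
  ∀ (g₂ g₃ e₁ xQ yQ : ℝ) (N : ℕ) (f : ℝ → ℝ), TorsionCentre g₂ g₃ e₁ xQ yQ N f →
    ∀ (R : KZ.IntegralRep (1 + 1)), JensenRep f e₁ xQ R →
      ∃ (c : ℝ) (C : KZ.IntegralRep (1 + 1)), 0 < c ∧ CarrierRep f e₁ c C ∧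
        (N : ℤ) • KZ.of R - KZ.of C ∈ KZ.relations

/-! ### The residual -/

/-- The crux's own tied torsion sector `T` (the generator set of `TorsionSectorComplete`, verbatim). -/
def TorsionTied : Set KZ.FormalRep := {d : KZ.FormalRep | ∃ (g₂ g₃ e₁ xP yP α : ℝ) (N a : ℕ) (M k m : ℤ) (f : ℝ → ℝ) (rI rP : KZ.IntegralRep 2) (rL : KZ.IntegralRep 1), (∀ x, f x = 4 * x ^ 3 - g₂ * x - g₃) ∧ g₂ ^ 3 - 27 * g₃ ^ 2 ≠ 0 ∧ f e₁ = 0 ∧ 0 < e₁ ∧ (∀ x, e₁ < x → 0 < f x) ∧ e₁ < xP ∧ yP ^ 2 = f xP ∧ 3 ≤ N ∧ 0 < a ∧ 2 * a < N ∧ 4 * (N : ℤ) ^ 2 * k = M * ((N : ℤ) - 2 * (a : ℤ)) ^ 2 ∧ (∀ hns : (⟨0, 0, 0, -g₂ / 4, -g₃ / 4⟩ : WeierstrassCurve ℝ).toAffine.Nonsingular xP (yP / 2), addOrderOf (WeierstrassCurve.Affine.Point.some xP (yP / 2) hns) = N) ∧ (N : ℝ) * (∫ x in Set.Ioi xP,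 (Real.sqrt (f x))⁻¹) = a * (2 * ∫ x in Set.Ioi e₁, (Real.sqrt (f x))⁻¹) ∧ 1 < α ∧ rI.domain = {z | e₁ < z 1 ∧ z 1 < z 0 ∧ z 0 < xP} ∧ Set.EqOn rI.integrand (fun z => z 1 / (Real.sqrt (f (z 1)) * Real.sqrt (f (z 0)))) rI.domain ∧ rP.domain = {z | e₁ < z 0 ∧ e₁ < z 1} ∧ Set.EqOn rP.integrand (fun z => (Real.sqrt (f (z 0)))⁻¹ * ((g₂ * z 1 + 2 * g₃) / (2 * (z 1) ^ 2 * Real.sqrt (f (z 1))))) rP.domain ∧ rL.domain = {t | 1 < t 0 ∧ t 0 < α} ∧ Set.EqOn rL.integrand (fun t => (t 0)⁻¹) rL.domain ∧ (M : ℝ) * rI.value + k * rP.value = m * rL.value ∧ d = M • KZ.of rI + k • KZ.of rP - m • KZ.of rL}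

/-- The set `T^{J}` of Jensen elements (the elements member `true` puts in `KZ.relations`). -/
def JensenElements : Set KZ.FormalRep :=
  {d | ∃ (g₂ g₃ e₁ xQ yQ α : ℝ) (N : ℕ) (j m : ℤ) (f : ℝ → ℝ) (R C : KZ.IntegralRep (1 + 1)),
    TorsionCentre g₂ g₃ e₁ xQ yQ N f ∧ 1 < α ∧ JensenRep f e₁ xQ R ∧ CarrierRep f e₁ α C ∧
    ((j : ℝ) * N) * R.value = m * C.value ∧ d = (j * (N : ℤ)) • KZ.of R - m • KZ.of C}

/-- **RESIDUAL `JensenSectorComplete` (conjecture-grade, declared residual):** completeness of the KZ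
calculus relative to the enlarged sector `T ∪ T^{J}`. Weaker than the crux by monotonicity. -/
def JensenSectorComplete : Prop :=
  ∀ ⦃n m : ℕ⦄ (r : KZ.IntegralRep n) (r' : KZ.IntegralRep m), r.IsRational → r'.IsRational →
    r.value = r'.value → KZ.of r - KZ.of r' ∈ KZ.relations ⊔ AddSubgroup.closure (TorsionTied ∪ JensenElements)

/-! ### Proved glue (no `sorry`) -/

/-- `TorsionSectorComplete` unfolds to completeness relative to `closure T`. -/
theorem torsionSectorComplete_iff :
    TorsionSectorComplete ↔ ∀ ⦃n m : ℕ⦄ (r : KZ.IntegralRep n) (r' : KZ.IntegralRep m), r.IsRational →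
      r'.IsRational → r.value = r'.value → KZ.of r - KZ.of r' ∈ KZ.relations ⊔ AddSubgroup.closure TorsionTied :=
  Iff.rfl

/-- Member `false` is the floor decl (definitional). -/
theorem member_false_iff : NeronJensenMember false ↔ NeronTorsionPrimitiveChain := Iff.rfl

/-- Member `true` is the Jensen sector (definitional). -/
theorem member_true_iff : NeronJensenMember true ↔ NeronJensenSector := Iff.rfl

/-- The rung is the conjunction of its two members. -/
theorem neronTorsionJensen_iff : NeronTorsionJensen ↔ NeronTorsionPrimitiveChain ∧ NeronJensenSector := by
  constructor
  · intro h; exact ⟨h false, h true⟩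
  · rintro ⟨h₀, h₁⟩ b; cases b
    · exact h₀
    · exact h₁

/-- **F3: the floor is the member `b = false`** (the seed `stub_assembly` by name). -/
@[aesop safe apply]
theorem rung_false : NeronJensenMember false :=
  Summit.KontsevichZagierPeriods.KontsevichZagierPeriods.Cruxes.NeronTorsionSector.Translation.stub_assembly

/-- The discriminant of the model `curve g₂ g₃` is `g₂³ − 27g₃²`. [folklore] -/
theorem curve_Δ (g₂ g₃ : ℝ) : (curve g₂ g₃).toAffine.Δ = g₂ ^ 3 - 27 * g₃ ^ 2 := by
  simp only [curve, WeierstrassCurve.Δ, WeierstrassCurve.b₂, WeierstrassCurve.b₄, WeierstrassCurve.b₆,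
    WeierstrassCurve.b₈]
  ring

/-- A real point `(x, y/2)` with `y² = f(x)`, `Δ ≠ 0`, is nonsingular on `curve g₂ g₃`. [folklore] -/
theorem curve_nonsingular {g₂ g₃ x y : ℝ} (hΔ : g₂ ^ 3 - 27 * g₃ ^ 2 ≠ 0) (f : ℝ → ℝ)
    (hf : ∀ x, f x = 4 * x ^ 3 - g₂ * x - g₃) (hy : y ^ 2 = f x) :
    (curve g₂ g₃).toAffine.Nonsingular x (y / 2) := by
  refine (WeierstrassCurve.Affine.equation_iff_nonsingular_of_Δ_ne_zero ?_).mp ?_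
  · rw [curve_Δ]; exact hΔ
  · rw [WeierstrassCurve.Affine.equation_iff]
    have h := hy
    rw [hf] at h
    dsimp only [curve]
    linear_combination (1 / 4 : ℝ) * h

/-- Stubs 1 and 2 give the interface `JensenNormChain`. -/
theorem jensenNormChain_of (h₁ : OrbitNormConstant) (h₂ : JensenChainOfNorm) : JensenNormChain := by
  intro g₂ g₃ e₁ xQ yQ N f hT R hR
  obtain ⟨hf, hΔ, he₁, hpos, hxQ, hyQ, hN, htor⟩ := hT
  have hQ : (curve g₂ g₃).toAffine.Nonsingular xQ (yQ / 2) := curve_nonsingular hΔ f hf hyQ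
  obtain ⟨c, hc, hnorm⟩ := h₁ g₂ g₃ xQ (yQ / 2) N hQ hΔ hN (htor hQ)
  have hnorm' : ∀ (hQ' : (curve g₂ g₃).toAffine.Nonsingular xQ (yQ / 2)) (x y : ℝ)
      (h : (curve g₂ g₃).toAffine.Nonsingular x y),
      (∀ k : ℕ, k < N →
        WeierstrassCurve.Affine.Point.some x y h
          + k • WeierstrassCurve.Affine.Point.some xQ (yQ / 2) hQ' ≠ 0) →
      ∏ k ∈ Finset.range N,
        (xCoord (WeierstrassCurve.Affine.Point.some x y h
            + k • WeierstrassCurve.Affine.Point.some xQ (yQ / 2) hQ') - xQ) ^ 2 = c :=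
    fun hQ' x y h hk => hnorm x y h hk
  obtain ⟨C, hC, hmem⟩ := h₂ g₂ g₃ e₁ xQ yQ N f c ⟨hf, hΔ, he₁, hpos, hxQ, hyQ, hN, htor⟩ hc hnorm' R hR
  exact ⟨c, C, hc, hC, hmem⟩


/-- Member `true` from the three pieces: orbit norm (stub 1), orbit-averaged chain (stub 2), sector
read-off (stub 3). -/
theorem neronJensenSector_of (h₁ : OrbitNormConstant) (h₂ : JensenChainOfNorm)
    (h₃ : JensenNormChain → NeronJensenSector) : NeronJensenSector :=
  h₃ (jensenNormChain_of h₁ h₂)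

/-- The rung from the three pieces (member `false` is the floor). -/
theorem neronTorsionJensen_of (h₁ : OrbitNormConstant) (h₂ : JensenChainOfNorm)
    (h₃ : JensenNormChain → NeronJensenSector) : NeronTorsionJensen :=
  neronTorsionJensen_iff.mpr ⟨rung_false, neronJensenSector_of h₁ h₂ h₃⟩

/-- Member `true` says exactly that every Jensen element is a chain of moves:
`closure T^{J} ≤ KZ.relations`. -/
theorem closure_jensenElements_le_relations (h : NeronJensenSector) :
    AddSubgroup.closure JensenElements ≤ KZ.relations := by
  refine (AddSubgroup.closure_le _).mpr ?_
  rintro d ⟨g₂, g₃, e₁, xQ, yQ, α, N, j, m, f, R, C, hT, hα, hR, hC, hval, rfl⟩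
  exact h g₂ g₃ e₁ xQ yQ α N j m f hT hα R C hR hC hval

/-- The residual is a consequence of the crux (hence of the summit): `closure T ≤ closure (T ∪ T^{J})`.
(Informational: the residual is WEAKER than the crux as typed.) [folklore] -/
theorem jensenSectorComplete_of_torsionSectorComplete (h : TorsionSectorComplete) :
    JensenSectorComplete := by
  intro n m r r' hr hr' hv
  have hmono : KZ.relations ⊔ AddSubgroup.closure TorsionTied ≤
      KZ.relations ⊔ AddSubgroup.closure (TorsionTied ∪ JensenElements) :=
    sup_le_sup_left (AddSubgroup.closure_mono Set.subset_union_left) _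
  exact hmono (torsionSectorComplete_iff.mp h r r' hr hr' hv)

/-- **Completeness transfer** (pure algebra): the Jensen chain folds `T^{J}` into the moves, so
`relations ⊔ closure (T ∪ T^{J}) ≤ relations ⊔ closure T`; with the residual this is the BODY of the
crux (`torsionSectorComplete_iff`). Stated on the unfolded body so that only `TorsionSectorComplete_of`
concludes the crux by name. -/
theorem completeness_transfer (hR : NeronJensenSector) (hC : JensenSectorComplete) :
    ∀ ⦃n m : ℕ⦄ (r : KZ.IntegralRep n) (r' : KZ.IntegralRep m), r.IsRational → r'.IsRational →
      r.value = r'.value → KZ.of r - KZ.of r' ∈ KZ.relations ⊔ AddSubgroup.closure TorsionTied := by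
  intro n m r r' hr hr' hv
  have hle : KZ.relations ⊔ AddSubgroup.closure (TorsionTied ∪ JensenElements) ≤
      KZ.relations ⊔ AddSubgroup.closure TorsionTied := by
    rw [AddSubgroup.closure_union]
    refine sup_le le_sup_left (sup_le le_sup_right ?_)
    exact le_sup_left.trans' (closure_jensenElements_le_relations hR)
  exact hle (hC r r' hr hr' hv)

/-! ### F4 ON-PATH: Conjecture 1 ⇒ the rung (UNCONDITIONAL, sorry-free) -/

/-- **Conjecture 1 ⇒ member `true`**: the kernel form of Conjecture 1 (`kzKernelConjecture_iff_isRational`)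
applied to the tied element `(jN)•[R_Q] − m•[C_α]`, whose evaluation vanishes by the value hypothesis. -/
@[aesop 95% apply]
theorem neronJensenSector_of_kontsevichZagierPeriods (h : _root_.KontsevichZagierPeriods) :
    NeronJensenSector := by
  have hK : KZKernelConjecture := kzKernelConjecture_iff_isRational.mpr h
  intro g₂ g₃ e₁ xQ yQ α N j m f hT hα R C hR hC hval
  apply hK
  simp only [map_sub, map_zsmul, KZ.eval_of, zsmul_eq_mul]
  push_cast
  linear_combination hval

/-- **F4 ON-PATH LEMMA: `KontsevichZagierPeriods → NeronTorsionJensen`** (unconditional: the rung is a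
consequence of the sub-problem statement; member `false` is the proved floor). Tagged as an `aesop` apply
rule so that the cheap forward portfolio (`intro h; aesop`) finds it. -/
@[aesop 95% apply]
theorem neronTorsionJensen_of_kontsevichZagierPeriods (h : _root_.KontsevichZagierPeriods) :
    NeronTorsionJensen :=
  neronTorsionJensen_iff.mpr ⟨rung_false, neronJensenSector_of_kontsevichZagierPeriods h⟩

example : _root_.KontsevichZagierPeriods → NeronTorsionJensen := neronTorsionJensen_of_kontsevichZagierPeriods

/-- F3 witness in the brief's literal shape. -/
example : NeronJensenMember false := by
  rw [member_false_iff]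
  exact Summit.KontsevichZagierPeriods.KontsevichZagierPeriods.Cruxes.NeronTorsionSector.Translation.stub_assembly

end Summit.KontsevichZagierPeriods.KontsevichZagierPeriods.Cruxes.TorsionSectorComplete.NeronTorsionJensen.OnPath
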